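import Mathlib
import HarnessLib
import HarnessLib.Audit
import Summits.Langlands.Statement
import Literature.NumberTheory.Automorphic.GaloisActionPlaces

/-!
Route: SmithKummer

CLOSED (retired) 2026-08-15T13:48:45Z by operator:999:1257524 — reason: not-a-thesis: assembly does not conclude the sub-problem Statement — note: D-0027 §2.1 audit (human 2026-08-15: routes that do not decide the summit are removed): the assembly concludes `ResidualGaloisRepKummer`, not the sub-problem statement; a NEW conforming route may be opened from the same idea (generated `closes : … → _root_.Langlands`).. The file is kept as the record of this route; refuted decls are indexed as negative knowledge (`ledger negatives`).

# Route SmithKummer — Smith-theoretic automorphic induction mod p — residual reciprocity at the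
pinned prime over Kummer-over-CM fields

It suffices to show X = X1 ∧ X2 (realising card Langlands/Langlands/smith-ai-mod-p), after which the
target T follows by pure logic (Assembly).
X1 = ResidualInductionKummer: for a prime p, a totally real or CM field M with μ_p ⊂ M, a cyclic (=
Kummer) extension F = M(a^{1/p}) of degree p, n ≥ 0, a regular algebraic cuspidal π of GL_n(𝔸_F), ι
: ℚ̄_p ≃ ℂ and a reduction red : ℤ̄_p → k = 𝔽̄_p: the Frobenius polynomials P_π(w) of π
(normalisation of lang.S27
`Literature.NumberTheory.Automorphic.exists_galoisRep_of_regularAlgebraic`) are p-integral at w ∤ p,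
and for every mod-p character χ of Γ_F there is R_χ : Γ_M → GL_{pn}(k) whose restriction to Γ_F has,
at almost every place w of F, characteristic polynomial ∏_{g ∈ Gal(F/M)} P̄_π(g·w) with roots scaled
by χ(Frob_{g·w}) — the Galois shadow of the automorphic induction of (π mod p) ⊗ χ from F to M.
Claimed mechanism: Treumann–Venkatesh Smith theory (ℤ/p-equivariant localisation + normalised Brauer
homomorphism) for the INNER Kummer automorphism σ = Ad(a^{1/p}) of GL_{pn}/M (fixed group
Res_{F/M}GL_n; or SL_{pn} with central bookkeeping), whose σ-dual map is automorphic induction (crux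
BrauerSatakeIsInduction, filed informally), followed by Scholze's torsion theorem over the TR/CM
field M; mod p no weight, purity or CM-ness condition survives, so the purity lock that kills
characteristic-0 induction from F is absent.
X2 = CliffordExtractionModP: pure Galois theory — from such a family (R_χ)_χ with
Gal(F/M)-equivariant twisted Frobenius data one extracts τ : Γ_F → GL_n(k) with charpoly τ(Frob_w) =
P(w) at almost all w.
T = ResidualGaloisRepKummer: every regular algebraic cuspidal π of GL_n over such an F has a mod-p
Galois representation ρ̄_{π,ι} : Γ_F → GL_n(𝔽̄_p), unramified with the predicted (reduced) Frobenius
polynomial at almost every place: the residual form, at the single prime ℓ = p = [F:M], of the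
existence clause of direction (A) `Summit.Langlands.AutomorphicToGalois` over the first family of
number fields that are neither totally real nor CM — ℚ(ζ_3, ∛m); at p = 2 every quadratic extension
of a totally real or CM field (ℚ(⁴√2), ℚ(i, ⁴√2), ℚ(√(1+√2))).
Lean: `ResidualInductionKummer → CliffordExtractionModP → ResidualGaloisRepKummer`
Honest scope: T → `Langlands` is NOT claimed. The mechanism is residual and sees one prime per
presentation (Ad(g) has prime order ℓ iff M(g)/M is radical of degree ℓ); ℓ ≠ p, characteristic 0,
compatibility at ramified places and at p, and direction (B) are outside this route. In the sense of
PROBLEMS.md §3 ("R1 for growing classes of (G, F, π)") the route enlarges the class of fields F for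
which a form of (A) is known beyond TR/CM, and T is the residual input (Calegari–Geraghty Conjecture
A mod p over F) that any automorphy-lifting route over such F must start from.

## Assembly
Pure logic plus bookkeeping, all in tree: fix p, M, F, n, π, ι, k, red as in T; X1 gives the
integral models P₀ and, for every χ (with its Frobenius values c, which exist a.e. since a
continuous character into discrete k^× has open kernel:
`FramedGaloisRep.eventually_isUnramifiedAt_of_isOpen_ker`), the representation R_χ; set P(w) :=
red(P₀(w)), monic of degree n at the cofinitely many w where π is unramified
(`Literature.NumberTheory.Automorphic.eventually_cofinite_isUnramifiedAt_holds`,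
`HasSatakeParamAt.card_eq`, `natDegree_arithFrobPolyOfSatake`); X2 yields τ with charpoly τ(Frob_w)
= P(w) a.e.; unramifiedness of τ a.e. is automatic (finite image), and uniqueness of Satake
parameters (`hasSatakeParamAt_unique`) matches the ∀ α clause: ρ̄ := τ proves T. The assembly
targets the slice T, not `_root_.Langlands` (see Thesis, honest scope).

Rationale: WHY THIS LINE. Every known construction of ρ_π realises π in the cohomology of a Shimura variety
(barrier ShimuraVarietyRealizationBarrier), impossible over a field F that is neither TR nor CM, and
characteristic-0 automorphic induction to the CM subfield is useless because Clozel/Raghuram purity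
makes AI(π) irregular (retired card weight-support-purity-lock, arXiv:2207.03393). Mod p both
obstructions dissolve: Treumann–Venkatesh (TreumannVenkatesh2016, §5.5 Theorem = First Main Theorem;
§4.3, §8.1) transport ANY mod-p Hecke eigenclass of the fixed group H = G^σ of an order-p
automorphism to G along the normalised Brauer homomorphism, and Scholze2015 Thm V.4.1 attaches
Galois representations to ANY mod-p eigenclass of GL_N over a TR/CM field, weights being invisible
mod p. The new move (card smith-ai-mod-p; elegance: the Kummer generator a^{1/p} that makes F a
"bad" field IS the order-p symmetry Smith theory needs — obstruction as resource) is to take σ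
INNER, σ = Ad(a^{1/p}) on GL_{pn}/M, so that H = Res_{F/M}GL_n lives over the non-CM field F while G
lives over the CM field M; the Kummer hypothesis μ_p ⊂ M is exactly what makes every residue
cardinality q_v ≡ 1 (mod p) (support KummerResidueCharOne), killing the half-sum/√q twists behind
TV's c-group caveat (§7.8, PGL_2/order-3 counterexample). Imported areas: equivariant algebraic
topology (P. A. Smith theory, Tate cohomology, Quillen/Borel localisation) and modular
representation theory (Brauer homomorphism), with TV's explicit dictionary (eigenclass of H ↦
eigenclass of G, Satake parameter moved by the σ-dual map); nearest prior uses: cyclic base change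
(TreumannVenkatesh2016 §1.2, Feng2024, arXiv:2205.04499) and the torus case over ℚ (Ash2003). No
prior route or negative exists on this summit (negatives index empty at filing).

RANKED CRUXES. Ranked: #2 BrauerSatakeIsInduction and #5 SmithTransferGL cannot be typed before the
definitions `normalizedBrauerHom`, `satakeTransformModP`, `modPHeckeEigensystemGL` land; they are
filed informal-only right after open (texts below) and are the foreseen children of #4. #2
(make-or-break, a day by hand): at a σ-good place v of M (v ∤ p·a·disc, q_v ≡ 1 mod p), TV's
normalised Brauer homomorphism ψ_v : ℋ(GL_{pn}(M_v), GL_{pn}(𝒪_v); k) → ℋ(∏_{w|v} GL_n(F_w), ∏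
GL_n(𝒪_w); k) is automorphic induction on k-characters up to the global Aut(k/𝔽_p)-twist of TV §4.3:
split v ↦ union of the p Satake multisets, inert v ↦ the p-th roots (unique in characteristic p);
why it might fail: TV Thm 8.1 pins ψ_v only up to finitely many "dual norms"/γ-admissible Borel
classes and a central element, H is reductive NOT semisimple so TV's Second Main Theorem supplies no
σ-dual map, and their PGL_2/inner-order-3 example (no σ-dual map at all) is the n = 1, degree-(p−1)
cousin of this construction; sources TreumannVenkatesh2016 §4.3 eq. (4.3), §7.7–7.8, §8.1; Ash2003.
#5 SmithTransferGL: TV's §5.5 Theorem holds for (GL_{pn}/M, Ad a^{1/p}) (fixed group connected) or,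
via the published semisimple simply-connected case SL_{pn}, every mod-p eigencharacter of SL_{pn}
away from S lifts to GL_{pn} with parameters controlled up to a GLOBAL character; why it might fail:
TV §5.4 uses reduction theory/Satake normalisation for semisimple G, and the SL→GL lift is a priori
determined only up to a place-dependent scalar s_v with s_v^{pn} a character — a μ_{n′}-ambiguity
(n′ = prime-to-p part of n), void for n = p^k; sources TreumannVenkatesh2016 §5, Scholze2015 V.4.
#0 ResidualGaloisRepKummer (target) — T: for p prime, M totally real or CM with a primitive p-th
root of unity, F/M Galois of degree p, every regular algebraic cuspidal π of GL_n(𝔸_F), every ι :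
ℚ̄_p ≃ ℂ and every reduction red of ℤ̄_p = 𝒪_{ℚ̄_p} into an algebraically closed discrete field k of
characteristic p, there is ρ̄ : Γ_F → GL_n(k) such that for all but finitely many places w: if π has
Satake parameter α at w then the lang.S27 Frobenius polynomial arithFrobPolyOfSatake ι q_w n α has
an integral model P₀ and ρ̄ is unramified at w with charpoly(ρ̄(Frob_w)) = red(P₀). Realises card
item X_p restricted to reductions of characteristic-0 regular algebraic π (the
all-torsion-eigensystems form waits for `modPHeckeEigensystemGL`). Non-vacuous: M = ℚ(ζ_3), F =
M(∛2), n = 1 (then T is class field theory: ρ̄ = reduction of the p-adic avatar of the algebraic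
Hecke character); p = 2, M = ℚ, F = ℚ(√-5) or any quadratic extension of a TR/CM field qualifies.
(why it might fail: Only through X1 ∧ X2; independently, a mod-p congruence obstruction is
conceivable only if Langlands reciprocity itself fails for such F (T is implied by
AutomorphicToGalois at ℓ = p plus integrality), so a refutation of T would refute the summit.)
[Scholze2015, TreumannVenkatesh2016, BuzzardGeeLMS2014, HarrisLanTaylorThorneRMS2016,
CalegariGeraghty2017]
#3 CliffordExtractionModP (crux) — Clifford extraction mod p (pure Galois theory, new): F/M Galois
of prime degree p = char k, k algebraically closed and discrete, P : places of F → k[X] monic of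
degree n at almost all w. IF for every continuous character χ : Γ_F → k^× (Frobenius values c(w)
a.e.) there is a continuous R_χ : Γ_M → GL_{pn}(k) whose restriction to Γ_F has charpoly(Frob_w) =
∏_{g ∈ Gal(F/M)} P(g·w).scaleRoots(c(g·w)) for almost all w, THEN there is τ : Γ_F → GL_n(k) with
charpoly τ(Frob_w) = P(w) for almost all w. (If τ exists, R_χ = Ind_F^M(τ ⊗ χ) satisfies the
hypothesis by Mackey and `FramedGaloisRep.hasFrobCharpolyAt_outerConj_iff`; the crux is the
converse. Tools in tree: AbsGaloisOuterConj (`nonempty_equiv_outerConj`), RestrictFieldSemisimple,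
FrobeniusDensityTheorem, LAdicRepFrobenius (Brauer–Nesbitt).) Planner's hand check: n = 1, p = 2
holds (incoherent choice data {ψ, ψ^σ} are excluded by generic χ because order-2 characters vanish
in characteristic 2). [difficulty: L] (why it might fail: The transfer keeps only the union over g
of twisted Frobenius data: a Gal(F/M)-equivariant 'coherent choice' datum P (pieces of some S ≅ S^g
with permuted eigenvalue multisets, small/induced image) matched by R_χ for all χ yet realised by no
τ refutes it; only n=1, p=2 hand-checked.) [SerreLinearRepresentations1977, ChenevierHarris2013,
Sorensen2020, TreumannVenkatesh2016, HarrisTaylorAMS2001]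
#4 ResidualInductionKummer (crux) — X1, the Galois shadow of Smith-theoretic automorphic induction
with twists: in the setting of T, the Frobenius polynomials of π at w ∤ p have integral models P₀(w)
(p-integrality of Hecke polynomials of cohomological π), and for every mod-p character χ of Γ_F with
Frobenius values c there is R_χ : Γ_M → GL_{pn}(k) with charpoly((R_χ|Γ_F)(Frob_w)) = ∏_{g ∈
Gal(F/M)} red(P₀(g·w)).scaleRoots(c(g·w)) for almost all w (the single formula covers split AND
inert w). Intended proof = TV First Main Theorem for (GL_{pn}/M, Ad a^{1/p}) or SL_{pn} [#5] applied
to the trivial-weight, deeper-level avatar (Franke/Borel cuspidal cohomology + Ash–Stevens reduction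
+ Hochschild–Serre, support AshStevensTrivialWeight) of the eigenclass of π ⊗ χ̃ (χ̃ = Teichmüller
lift, `CuspidalAutomorphicRepData.twist`), + crux #2 (σ-dual = induction, all √q-twists trivial
since q_v ≡ 1 mod p), + Scholze2015 Thm V.4.1 (m = 1) for GL_{pn}/M as a named fact (support
ScholzeTorsionInput), + the dictionary Ind/restriction of Frobenius polynomials
(`hasFrobCharpolyAt_outerConj_iff`). [deps: CliffordExtractionModP] [difficulty: XL] (why it might
fail: Rests on #2 (Brauer–Satake = induction; TV's PGL2/order-3 example shows σ-dual maps can fail)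
and #5 (TV published for semisimple G only; SL→GL lift has a μ_{n'} scalar ambiguity for p∤n), plus
level/σ-plainness at places dividing a·disc(F/M) and Scholze's normalisation mod p.)
[TreumannVenkatesh2016, Scholze2015, Ash2003, Feng2024, arXiv:1407.2346, arXiv:1306.2070]
#9 KummerResidueCharOne (support) — If the number field M contains a primitive p-th root of unity
then every finite place v ∤ p has residue cardinality q_v ≡ 1 (mod p) (μ_p injects into the residue
field). This is why the Kummer hypothesis removes every half-sum / √q normalisation twist from the
mod-p Satake and Brauer–Satake formulas (TV §7.8 c-group caveat) and why at p = 2 no hypothesis is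
needed. [difficulty: provable-now] [TreumannVenkatesh2016, NeukirchANT1999]

TWO-LAYER PLAN. Foreseen glued split once definitions land (tenure): ResidualInductionKummer ⇐
BrauerSatakeIsInduction → SmithTransferGL → ScholzeInductionGlue → ResidualInductionKummer, where
ScholzeInductionGlue = (Scholze2015 V.4.1 as hypothesis `(h : …) →`) + AshStevensTrivialWeight +
integrality + the Ind/restriction charpoly dictionary. CliffordExtractionModP ⇐ (generic case: P(w)
with distinct roots and R_1|Γ_F multiplicity-free) → (twisting argument: the χ-independent
constituent) → CliffordExtractionModP, only if a prover's census asks for it. Nothing filed now.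

KILL CRITERIA. (i) #2 computed at one split and one inert place and found NOT to be induction even
after TV's global Aut(k)-twist and a central character — close `refuted:BrauerSatakeIsInduction`
unless TV §7.8 c-groups repair it (then restate #2, pivot, same route). (ii) A counterexample datum
to CliffordExtractionModP: restate X2 with the extra structure the mechanism really provides
(multiplicativity in χ, determinant = transfer of the central character, compatibility with
R_{χχ'}); close only if the counterexample is realised by a genuine eigensystem. (iii) Refuter
numerics (kit): p = 3, M = ℚ(ζ_3), F = M(∛2), n = 1: a mod-3 ray-class character of F whose induced
3-dimensional eigen-system is absent from H^*(Γ ≤ GL_3(ℤ[ζ_3]), 𝔽_3) at the predicted level refutes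
X1 (cf. Ash2003, who verified the analogous torus statement over ℚ). (iv) T refuted directly would
refute `AutomorphicToGalois` for that F (T follows from the summit + integrality), i.e. the summit —
record as a negative of the summit, not only of the route. (v) Torsion Galois representations over
arbitrary number fields proved elsewhere moot the route (supersede).

NOT DECOMPOSED YET. The internal glue of X1 (TV transfer instance, Scholze as named fact, Franke +
Ash–Stevens weight-to-level, p-integrality of Hecke polynomials, σ-plain levels at places dividing
a·disc(F/M)); the small-image / repeated-root cases of X2; everything at ramified places and at v |
p (TV §6 'linkage', out of scope); characteristic 0 (TV §1.3 (i)–(iii) needs modularity lifting over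
F, blocked by Literature.Barriers.Langlands.TaylorWilesNumericalCoincidence since l₀(F) > 0 — a
different route); the all-torsion form X_p of the card (waits for `modPHeckeEigensystemGL`); descent
from F to fields K with K·M′ Kummer of degree p over a CM field M′ (e.g. every complex cubic field K
at p = 3 via K(ζ_3, √disc)) by Sorensen patching
(`Literature/NumberTheory/GaloisRepresentations/SorensenPatching`) — an expansion filed only after T
moves.

CHEAPEST FALSIFIER. The split-place Brauer–Satake computation for n = 1, p = 3: G = GL_3(M_v) (or
SL_3), σ = Ad(diag(a₁,a₂,a₃)) with a_i ∈ 𝒪_v^× distinct mod v, q_v ≡ 1 (mod 3), H = torus; TV eq.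
(4.3) NBr(h)(U, gU) = ((h*h*h)(K, gK))^{1/3}. Planner's hand computation: since σ = Ad(t) with t ∈ K
acts trivially on ℋ(G, K), Br is restriction to the Levi/torus and NBr is its Frobenius twist, so
the transferred parameter is s ↦ s^p, undone globally by Aut(k/𝔽_p) (TV §4.3, proof of the Theorem)
— consistent with induction at split places, and the same untwist turns β into β^{1/p} at inert
places. Not machine-checked; the inert place (H_v = GL_1(F_w), F_w/M_v unramified cubic) is the
first thing a refuter should do, then Ash2003's torus-over-ℚ theorem as an external check of
normalisations.

NUMBERS. [F:M] = p = char k = ord(σ); q_v ≡ 1 (mod p) for all v ∤ p (Kummer); TV: all but finitely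
many places σ-good (Prop. 5.? 'σ-good'), level K σ-stable with K^σ = U and K sufficiently small
(§5.3 (a)–(d)); Scholze V.4.1: S ⊇ {v | p} ∪ {v ramified over M⁺}, nilpotent ideal of exponent
N([M:ℚ], pn) (irrelevant mod eigen-characters); dimension count behind the purity lock: AI(π)_∞ at a
place of M repeats each Hodge–Tate pair p times.

DEFINITION REQUESTS. (D1) `modPHeckeEigensystemGL` (topic Literature/NumberTheory/Automorphic): for
a number field F, N ≥ 1, a commutative coefficient ring k, a finite set S of finite places and a
level K = K_S·K^S ⊂ GL_N(𝔸_F^∞) with K^S = ∏_{v∉S} GL_N(𝒪_v): the singular cohomology H^i(X_K, k) of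
Scholze's locally symmetric space X_K (Scholze2015 V.4, stacky/orbifold convention when K is not
neat, or group cohomology of the arithmetic groups) with the action of ⊗_{v∉S} ℋ(GL_N(F_v),
GL_N(𝒪_v); k) (tree: `Literature.NumberTheory.Automorphic.heckeAlgebra`), and `OccursIn θ` for a
k-character θ of that algebra; needed to state TreumannVenkatesh2016 §5.5 and Scholze2015 V.4.1 as
named facts and to type #2/#5 and the all-torsion target. (D2) `normalizedBrauerHom` (topic
Literature/NumberTheory/Automorphic): TV §4.1–4.3 for a group G, σ ∈ Aut G of prime order p, a
σ-stable σ-plain subgroup K, k of characteristic p: Br : ℋ(G,K;k)^σ → ℋ(G^σ,K^σ;k) by restriction of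
K-bi-invariant functions (`heckeAlgebra.doubleCosetCoeffEquiv`), and the k-linear NBr with
NBr(h)(K^σgK^σ) = ((h^{*p})(KgK))^{1/p} on 𝔽_p-valued h. (D3) `satakeTransformModP` (topic
Literature/NumberTheory/Automorphic): `satakeTransform` for GL_N over a local field with
coefficients in any commutative ring R with q ∈ R^× (same integral normalisation q^{-⟨ν,e⟩} as the ℂ
version), and Satake parameters of k-valued characters for k algebraically closed. Cite facts wanted
(kind cite, trunk NumberTheory/Automorphic): TreumannVenkatesh2016 §5.5 Theorem (First Main Theorem:
χ occurs in H^*([H]_U; k) ⇒ χ∘NBr occurs in H^*([G]_K; k), V any set of σ-good places); Scholze2015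
Thm V.4.1 / Conj. I.2 = Thm I.3 for m = 1 (mod-p eigen-systems of GL_N over TR/CM fields have Galois
determinants with D(1 − X·Frob_v) = P_v(X)); Ash2003 main theorem (torus case over ℚ). Acquisition:
acq-02155 (Ash2003 text).

Novelty: Searches (2026-08-15; local searchd and OpenAlex/S2/arXiv remote tiers unavailable or rate-limited
this session, zbMATH and galaxy worked): lit search --source zbmath "Smith theory Brauer
homomorphism automorphic" (1: TreumannVenkatesh2016), "Smith theory cyclic base change" (2:
Feng2024, doi:10.1112/s0010437x24007243), "Tate cohomology functoriality mod p" (Ronchetti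
arXiv:1507.00745, Dhar arXiv:2608.04674), "automorphic induction mod p torsion" (0 relevant),
"Galois representations torsion classes cubic fields" (0 relevant), "Smith theory and Hecke
operators Ash" (1: Ash2003); lit galaxy search --star all "Smith theory and Hecke operators" (0) and
--star pdf --mode intelligent "Smith theory Hecke eigenclass induced Galois representation
cyclotomic" (0 relevant); lit frontier Langlands --since 2020 and lit bridges Langlands --cross any
(nothing on Smith theory); TV arXiv:1407.2346 read pp. 3–4, 12–17, 24–26, 45; Scholze
arXiv:1306.2070 pp. 3, 60–61, 66; plus the card's novelty audit (arXiv:1407.2346, 2009.14236,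
1507.00745, 1306.2070, 2109.14145, 2207.03393).
Nearest prior art found: Ash2003 (doi:10.1016/s0021-8693(02)00547-1; cited by TV §1.3 "uses Smith
theory to produce homology for GL_n over certain fields"): the representation of Γ_ℚ INDUCED from an
𝔽̄_p^×-valued ray class character of ℚ(ζ_p) is attached to a mod-p Hecke eigenclass — i.e.
Smith-theoretic automorphic induction for the cyclotomic inner automorphism Ad(ζ_p) (torus source, n
= 1, CM source field, degree p −  [refs: 10.1112/s0010437x24007243, 10.1016/s0021-8693(02, 1507.00745, 2608.04674, 1407.2346, 1306.2070, doi:10.1112/s0010437x24007243, doi:10.1016/s0021-8693, TreumannVenkatesh2016, Feng2024, Ash2003, Scholze2015]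

Barriers (technique_class: smith-theory torsion-functoriality automorphic-induction): - technique_class: smith-theory torsion-functoriality automorphic-induction
- Literature.Barriers.Langlands.ShimuraVarietyRealizationBarrier: sidestepped for the residual
statement — the Galois representation is still born in a Shimura variety (Scholze's torsion classes
of GL_{pn} over the CM/TR field M via the Siegel/unitary boundary), but π over F is never realised
in the cohomology of a variety: its mod-p eigenclass is moved TOPOLOGICALLY (ℤ/p-localisation of the
locally symmetric space of GL_{pn}/M at the fixed locus of Ad(a^{1/p})) to M, where
`equalRankResGL`-type obstructions are irrelevant for torsion classes. The barrier's proved content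
(`ShimuraVarietyRealizationBarrier_holds`: no discrete series for Res_{F/ℚ}GL_n unless n ≤ 1 or n =
2, F TR) is untouched and not contradicted.
- Literature.Barriers.Langlands.NonRegularWeightBarrier: evaded mod p only — in characteristic 0 the
induced representation AI(π) on GL_{pn}/M is irregular by purity/weight-support (each archimedean
weight repeated p times), which is exactly why the route stops at the residual statement;
torsion/mod-p eigenclasses carry no weight (Scholze V.4.1 reduces every ξ to trivial weight at
deeper level), so `NonRegularWeightBarrier_holds` does not bear on X1.
- Literature.Barriers.Langlands.TaylorWilesNumericalCoincidence: not engaged (no patching, no R =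
T); it WILL bite any sequel lifting ρ̄ to characteristic 0 over F (l₀(F) > 0), which is deliberately
not part of this route.
- Literature.Barriers.L

History (route lifecycle, newest last):
- 2026-08-15T13:48:45Z · CLOSED retired — not-a-thesis: assembly does not conclude the sub-problem Statement (operator:999:1257524)

sub-problem: Langlands · status: closed(retired) · opened planner-plancard-Langlands-Langlands-smith-ai-3012b3a8-0 2026-08-15T11:06:47Z · rev 1 · ledger route-Langlands-SmithKummer
GENERATED by the gate from the ledger (D-0016/17). Provers cite these decls: `theorem foo : Summit.Langlands.Langlands.Theses.SmithKummer.<Decl> := …` in Summits/Langlands/Langlands/Theorems/<Name>.lean.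
-/

namespace Summit.Langlands.Langlands.Theses.SmithKummer

open scoped BigOperators Topology Manifold Classical MeasureTheory ProbabilityTheory Matrix InnerProductSpace ComplexConjugate ContinuousMap
open Filter Set Function TopologicalSpace MeasureTheory

attribute [summit_statement] _root_.Langlands

/-- item stmt-Langlands-2674 · target · rank 0 · closed · moot by None · by planner
why it might fail: Only through X1 ∧ X2; independently, a mod-p congruence obstruction is conceivable only if Langlands reciprocity itself fails for such F (T is implied by AutomorphicToGalois at ℓ = p plus integrality), so a refutation of T would refute the summit.
sources: Scholze2015, TreumannVenkatesh2016, BuzzardGeeLMS2014, HarrisLanTaylorThorneRMS2016, CalegariGeraghty2017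
[target] T: for p prime, M totally real or CM with a primitive p-th root of unity, F/M Galois of
degree p, every regular algebraic cuspidal π of GL_n(𝔸_F), every ι : ℚ̄_p ≃ ℂ and every reduction
red of ℤ̄_p = 𝒪_{ℚ̄_p} into an algebraically closed discrete field k of characteristic p, there is
ρ̄ : Γ_F → GL_n(k) such that for all but finitely many places w: if π has Satake parameter α at w
then the lang.S27 Frobenius polynomial arithFrobPolyOfSatake ι q_w n α has an integral model P₀ and
ρ̄ is unramified at w with charpoly(ρ̄(Frob_w)) = red(P₀). Realises card item X_p restricted to
reductions of characteristic-0 regular algebraic π (the all-torsion-eigensystems form waits for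
`modPHeckeEigensystemGL`). Non-vacuous: M = ℚ(ζ_3), F = M(∛2), n = 1 (then T is class field theory:
ρ̄ = reduction of the p-adic avatar of the algebraic Hecke character); p = 2, M = ℚ, F = ℚ(√-5) or
any quadratic extension of a TR/CM field qualifies. -/
@[route_item "route-Langlands-SmithKummer"]
def ResidualGaloisRepKummer : Prop :=
  ∀ (p : ℕ) [Fact p.Prime] (M F : Type) [Field M] [NumberField M] [Field F] [NumberField F] [Algebra M F] [IsGalois M F], (NumberField.IsTotallyReal M ∨ NumberField.IsCMField M) → (∃ ζ : M, IsPrimitiveRoot ζ p) → Module.finrank M F = p → ∀ (n : ℕ) (hcpt : Literature.NumberTheory.Automorphic.isCompact_glFiniteIntegralLevel n F) (π : Literature.NumberTheory.Automorphic.CuspidalAutomorphicRepData n F hcpt), π.1.IsRegularAlgebraic → ∀ (ι : PadicAlgCl p ≃+* ℂ) (k : Type) [Field k] [CharP k p] [IsAlgClosed k] [TopologicalSpace k] [DiscreteTopology k] (red : (Valued.v : Valuation (PadicAlgCl p) NNReal).valuationSubring →+* k), ∃ ρ : Literature.NumberTheory.GaloisRepresentations.FramedGaloisRep F k n, ∀ᶠ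 w in Filter.cofinite, ∀ α : Multiset ℂ, π.1.HasSatakeParamAt w α → ∃ P₀ : Polynomial (Valued.v : Valuation (PadicAlgCl p) NNReal).valuationSubring, P₀.map (Valued.v : Valuation (PadicAlgCl p) NNReal).valuationSubring.subtype = Literature.NumberTheory.Automorphic.arithFrobPolyOfSatake ι w.residueCard n α ∧ ρ.IsUnramifiedAt w ∧ ρ.HasFrobCharpolyAt w (P₀.map red)

-- item stmt-Langlands-2814 · crux · rank 2 · closed · moot by None · by planner — informal only, no Lean statement yet:
--   [crux] BrauerSatakeIsInduction (rank 2; make-or-break; informal until definitions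
--   normalizedBrauerHom + satakeTransformModP land). Setting: p prime, M ⊇ μ_p a number field, F =
--   M(a^{1/p}) cyclic of degree p, v a finite place of M with v ∤ p·a·disc(F/M) (so q_v ≡ 1 mod p,
--   KummerResidueCharOne), k = 𝔽̄_p. G_v = GL_{pn}(M_v) ⊃ K_v = GL_{pn}(𝒪_v) (integral model adapted to
--   𝒪_F ⊗ 𝒪_v ≅ 𝒪_v^{pn}), σ = Ad(a^{1/p} ⊗ 1) (order p, K_v σ-stable and σ-plain), H_v = G_v^σ =
--   ∏_{w|v} GL_n(F_w), U_v = K_v^σ = ∏_{w|v} GL_n(𝒪_w). CLAIM: for every k-character θ of ℋ(H_v, U_v; k)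
--   with Satake parameters (α_w)_{w|v

/-- item stmt-Langlands-2675 · crux · rank 3 · closed · moot by None · by planner
why it might fail: The transfer keeps only the union over g of twisted Frobenius data: a Gal(F/M)-equivariant 'coherent choice' datum P (pieces of some S ≅ S^g with permuted eigenvalue multisets, small/induced image) matched by R_χ for all χ yet realised by no τ refutes it; only n=1, p=2 hand-checked.
sources: SerreLinearRepresentations1977, ChenevierHarris2013, Sorensen2020, TreumannVenkatesh2016
[crux] Clifford extraction mod p (pure Galois theory, new): F/M Galois of prime degree p = char k, k
algebraically closed and discrete, P : places of F → k[X] monic of degree n at almost all w. IF for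
every continuous character χ : Γ_F → k^× (Frobenius values c(w) a.e.) there is a continuous R_χ :
Γ_M → GL_{pn}(k) whose restriction to Γ_F has charpoly(Frob_w) = ∏_{g ∈ Gal(F/M)}
P(g·w).scaleRoots(c(g·w)) for almost all w, THEN there is τ : Γ_F → GL_n(k) with charpoly τ(Frob_w)
= P(w) for almost all w. (If τ exists, R_χ = Ind_F^M(τ ⊗ χ) satisfies the hypothesis by Mackey and
`FramedGaloisRep.hasFrobCharpolyAt_outerConj_iff`; the crux is the converse. Tools in tree:
AbsGaloisOuterConj (`nonempty_equiv_outerConj`), RestrictFieldSemisimple, FrobeniusDensityTheorem,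
LAdicRepFrobenius (Brauer–Nesbitt).) Planner's hand check: n = 1, p = 2 holds (incoherent choice
data {ψ, ψ^σ} are excluded by generic χ because order-2 characters vanish in characteristic 2).
[difficulty: L] -/
@[route_item "route-Langlands-SmithKummer"]
def CliffordExtractionModP : Prop :=
  ∀ (p : ℕ) [Fact p.Prime] (M F : Type) [Field M] [NumberField M] [Field F] [NumberField F] [Algebra M F] [IsGalois M F], Module.finrank M F = p → ∀ (k : Type) [Field k] [CharP k p] [IsAlgClosed k] [TopologicalSpace k] [DiscreteTopology k] (n : ℕ) (P : IsDedekindDomain.HeightOneSpectrum (NumberField.RingOfIntegers F) → Polynomial k), (∀ᶠ w in Filter.cofinite, (P w).Monic ∧ (P w).natDegree = n) → (∀ (χ : Literature.NumberTheory.GaloisRepresentations.FramedGaloisRep F k 1) (c : IsDedekindDomain.HeightOneSpectrum (NumberField.RingOfIntegers F) → k), (∀ᶠ w in Filter.cofinite, χ.HasFrobCharpolyAt w (Polynomial.X - Polynomial.C (c w))) → ∃ R : Literature.NumberTheory.GaloisRepresentations.FramedGaloisRep M k (p * n), ∀ᶠ w in Filter.cofinite, (R.restrictField F).HasFrobCharpolyAt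 w (∏ᶠ g : F ≃ₐ[M] F, (P (g • w)).scaleRoots (c (g • w)))) → ∃ τ : Literature.NumberTheory.GaloisRepresentations.FramedGaloisRep F k n, ∀ᶠ w in Filter.cofinite, τ.HasFrobCharpolyAt w (P w)

/-- item stmt-Langlands-2676 · crux · rank 4 · closed · moot by None · by planner
why it might fail: Rests on #2 (Brauer–Satake = induction; TV's PGL2/order-3 example shows σ-dual maps can fail) and #5 (TV published for semisimple G only; SL→GL lift has a μ_{n'} scalar ambiguity for p∤n), plus level/σ-plainness at places dividing a·disc(F/M) and Scholze's normalisation mod p.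
sources: TreumannVenkatesh2016, Scholze2015, Ash2003, Feng2024
[crux] X1, the Galois shadow of Smith-theoretic automorphic induction with twists: in the setting of
T, the Frobenius polynomials of π at w ∤ p have integral models P₀(w) (p-integrality of Hecke
polynomials of cohomological π), and for every mod-p character χ of Γ_F with Frobenius values c
there is R_χ : Γ_M → GL_{pn}(k) with charpoly((R_χ|Γ_F)(Frob_w)) = ∏_{g ∈ Gal(F/M)}
red(P₀(g·w)).scaleRoots(c(g·w)) for almost all w (the single formula covers split AND inert w).
Intended proof = TV First Main Theorem for (GL_{pn}/M, Ad a^{1/p}) or SL_{pn} [#5] applied to the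
trivial-weight, deeper-level avatar (Franke/Borel cuspidal cohomology + Ash–Stevens reduction +
Hochschild–Serre, support AshStevensTrivialWeight) of the eigenclass of π ⊗ χ̃ (χ̃ = Teichmüller
lift, `CuspidalAutomorphicRepData.twist`), + crux #2 (σ-dual = induction, all √q-twists trivial
since q_v ≡ 1 mod p), + Scholze2015 Thm V.4.1 (m = 1) for GL_{pn}/M as a named fact (support
ScholzeTorsionInput), + the dictionary Ind/restriction of Frobenius polynomials
(`hasFrobCharpolyAt_outerConj_iff`). [deps: CliffordExtractionModP] [difficulty: XL] -/
@[route_item "route-Langlands-SmithKummer"]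
def ResidualInductionKummer : Prop :=
  ∀ (p : ℕ) [Fact p.Prime] (M F : Type) [Field M] [NumberField M] [Field F] [NumberField F] [Algebra M F] [IsGalois M F], (NumberField.IsTotallyReal M ∨ NumberField.IsCMField M) → (∃ ζ : M, IsPrimitiveRoot ζ p) → Module.finrank M F = p → ∀ (n : ℕ) (hcpt : Literature.NumberTheory.Automorphic.isCompact_glFiniteIntegralLevel n F) (π : Literature.NumberTheory.Automorphic.CuspidalAutomorphicRepData n F hcpt), π.1.IsRegularAlgebraic → ∀ (ι : PadicAlgCl p ≃+* ℂ) (k : Type) [Field k] [CharP k p] [IsAlgClosed k] [TopologicalSpace k] [DiscreteTopology k] (red : (Valued.v : Valuation (PadicAlgCl p) NNReal).valuationSubring →+* k), ∃ P₀ : IsDedekindDomain.HeightOneSpectrum (NumberField.RingOfIntegers F) → Polynomial (Valued.v : Valuation (PadicAlgCl p) NNReal).valuationSubring, (∀ (w : IsDedekindDomain.HeightOneSpectrum (NumberField.RingOfIntegers F)) (α : Multiset ℂ), π.1.HasSatakeParamAt w α → ((p : ℕ) : NumberField.RingOfIntegers F) ∉ w.asIdeal → (P₀ w).map (Valued.v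 : Valuation (PadicAlgCl p) NNReal).valuationSubring.subtype = Literature.NumberTheory.Automorphic.arithFrobPolyOfSatake ι w.residueCard n α) ∧ ∀ (χ : Literature.NumberTheory.GaloisRepresentations.FramedGaloisRep F k 1) (c : IsDedekindDomain.HeightOneSpectrum (NumberField.RingOfIntegers F) → k), (∀ᶠ w in Filter.cofinite, χ.HasFrobCharpolyAt w (Polynomial.X - Polynomial.C (c w))) → ∃ R : Literature.NumberTheory.GaloisRepresentations.FramedGaloisRep M k (p * n), ∀ᶠ w in Filter.cofinite, (R.restrictField F).HasFrobCharpolyAt w (∏ᶠ g : F ≃ₐ[M] F, ((P₀ (g • w)).map red).scaleRoots (c (g • w)))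

-- item stmt-Langlands-2815 · crux · rank 5 · closed · moot by None · by planner — informal only, no Lean statement yet:
--   [crux] SmithTransferGL (rank 5; informal until modPHeckeEigensystemGL lands; foreseen child of
--   ResidualInductionKummer). CLAIM (TV First Main Theorem in the Kummer-inner instance): p, M ⊇ μ_p, F
--   = M(a^{1/p}) as above; G = GL_{pn}/M, σ = Ad(a^{1/p}) (fixed group H = Res_{F/M} GL_n, connected), K
--   ⊂ G(𝔸_M^∞) σ-stable and sufficiently small with U = K^σ, V the set of σ-good places (all but
--   finitely many; TV §5.1 and the Proposition on σ-good places); if a k-character χ of ℋ(H_V, U_V; k)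
--   occurs in H^*([H]_U; k) (singular cohomology of the adelic locally symmetric space, k = 𝔽̄_p) then χ
--   ∘ NBr occur

/-- item stmt-Langlands-2677 · support · rank 9 · closed · moot by None · by planner
sources: TreumannVenkatesh2016, NeukirchANT1999
[support] If the number field M contains a primitive p-th root of unity then every finite place v ∤
p has residue cardinality q_v ≡ 1 (mod p) (μ_p injects into the residue field). This is why the
Kummer hypothesis removes every half-sum / √q normalisation twist from the mod-p Satake and
Brauer–Satake formulas (TV §7.8 c-group caveat) and why at p = 2 no hypothesis is needed.
[difficulty: provable-now] -/
@[route_item "route-Langlands-SmithKummer"]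
def KummerResidueCharOne : Prop :=
  ∀ (p : ℕ) [Fact p.Prime] (M : Type) [Field M] [NumberField M], (∃ ζ : M, IsPrimitiveRoot ζ p) → ∀ v : IsDedekindDomain.HeightOneSpectrum (NumberField.RingOfIntegers M), ((p : ℕ) : NumberField.RingOfIntegers M) ∉ v.asIdeal → v.residueCard ≡ 1 [MOD p]

-- item stmt-Langlands-2816 · support · rank 9 · closed · moot by None · by planner — informal only, no Lean statement yet:
--   [support] ScholzeTorsionInput (rank 9; named fact wanted, informal until modPHeckeEigensystemGL
--   lands). Scholze2015 Thm V.4.1 with m = 1, used as a hypothesis `(h : Scholze2015_thmV41) →` in the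
--   proof of ResidualInductionKummer: M totally real or CM, N ≥ 1, p prime, S ⊇ {v | p} ∪ {v ramified
--   over M⁺} finite and conjugation-stable, K = K_S K^S with K^S = ∏_{v∉S} GL_N(𝒪_v): for every system
--   of eigenvalues θ : 𝕋_{M,S} = ⊗_{v∉S} ℤ_p[GL_N(M_v)//GL_N(𝒪_v)] → k = 𝔽̄_p occurring in H^i(X_K, 𝔽_p)
--   (any i; any algebraic weight reduces to this) there is a continuous semisimple ρ̄_θ : Γ_M → GL_N(k),
--   unrami

-- item stmt-Langlands-2817 · support · rank 9 · closed · moot by None · by planner — informal only, no Lean statement yet: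
--   [support] AshStevensTrivialWeight (rank 9; standard facts, informal until modPHeckeEigensystemGL
--   lands). For a number field F, n ≥ 1, a regular algebraic cuspidal π of GL_n(𝔸_F) unramified outside
--   S, ι : ℚ̄_p ≃ ℂ: (i) (Borel / Clozel 1990 Lemme 3.14–3.15 / Franke 1998) π_f^{K} contributes to the
--   cuspidal cohomology H^*_{cusp}(X_K, V_ξ) for the algebraic weight ξ determined by π_∞ and some level
--   K = K_S K^S, Hecke-equivariantly away from S; (ii) (integrality) hence the Hecke eigenvalues of π
--   away from S ∪ {v | p} are p-integral, i.e. the lang.S27 Frobenius polynomials arithFrobPolyOfSatake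
--   ι q_

/-- item stmt-Langlands-2678 · assembly · rank 1 · closed · moot by None · by planner
sources: TreumannVenkatesh2016, Scholze2015
[assembly] ResidualInductionKummer → CliffordExtractionModP → ResidualGaloisRepKummer (X1 → X2 → T). -/
@[route_item "route-Langlands-SmithKummer"]
def Assembly : Prop :=
  ResidualInductionKummer → CliffordExtractionModP → ResidualGaloisRepKummer

end Summit.Langlands.Langlands.Theses.SmithKummer
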